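import Summits.KontsevichZagierPeriods.Zeta5Search.Barrier.ConeGammaCrossings

/-!
# ζ(5) search — BARRIER: the HEAD period of the perturbed orbit is `O(ε)` at harmonic (not `T²`) scale

HONEST FRAMING (cell `pub-zeta5`): systematic search; no irrationality claim unless kernel-certified. MODEL objects
under Brown–Zudilin's (28)+(30) accounting ([BZ22] = arXiv:2210.03391; (28) observed, not proved); nothing here is a
statement about `ζ(5)`, about `γ`, or about the cone's supremum (C2 = `BarrierC2` stays OPEN; the lemma S-E with
useful constants stays CONJECTURED); records in print UNMOVED. Prover P2 g20 (self-selected Lean-only item of the P2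
lineage; source: lead/lit g27 `SE-DESK-NOTE.md` §2, third bullet «Head»).

With `Δ_ε(u) := 𝒩(u·s(a) + (uε)·δ) − 𝒩(u·s(a))` (the integrand of `Φ(s(a) + εδ) − Φ(s(a))` in torus form),
`x_k = h_k(a) > 0`, `φ_k = φ_k(δ)`:

* `floor_eq_sum_ite`, `abs_floor_sub_floor_le_sum` — layer cake: for `0 ≤ p, q < M + 1`,
  `|⌊p⌋ − ⌊q⌋| ≤ Σ_{m=1}^{M} |𝟙[m ≤ p] − 𝟙[m ≤ q]|`;
* `abs_ite_sub_ite_le_indicator` — level `m` of the form `k` disagrees between `u·x` and `u·y` only for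
  `u ∈ [m/max(x,y), m/min(x,y)]`;
* `integral_Icc_inv_sq`, `setIntegral_indicator_inv_sq_le` — the `u⁻²`-mass of that interval is
  `max/m − min/m = |y − x|/m` (here `= ε|φ_k|/m`: the desk note's «EXACTLY ε|φ_f(v̂)|/m», as an upper bound);
* **`abs_head_integral_le_harmonic`** — hence, with fact (a) of `ConeGammaCrossings`,
  `|∫₀ᵀ Δ_ε(u) u⁻² du| ≤ ε·(Σ_k |φ_k(δ)|)·(1 + log(T·x_max + 1))` for `εT·Y ≤ 1`, `ε·Y ≤ x_min/2`
  (harmonic sum over the levels `m ≤ T·x_k + 1`, `harmonic_le_one_add_log`) — P2 g19's `abs_head_integral_le`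
  has `(2x_max)²·εT·392·Y·(T·x_max + 5)/x_min` here.
Not here: anything about `Φ` (`ConeGammaTranslateDominanceSharp`).
-/

noncomputable section

open Set MeasureTheory
open scoped Topology

namespace Summit.KontsevichZagierPeriods.Zeta5Search.Barrier.ConeGamma

/-! ### Layer cake for the floor -/

/-- For `0 ≤ p < M + 1`: `⌊p⌋ = Σ_{j<M} 𝟙[j + 1 ≤ p]` (the number of positive integer levels below `p`). -/
theorem floor_eq_sum_ite {p : ℝ} (hp : 0 ≤ p) {M : ℕ} (hpM : p < M + 1) :
    (⌊p⌋ : ℝ) = ∑ j ∈ Finset.range M, if (j : ℝ) + 1 ≤ p then (1 : ℝ) else 0 := by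
  rw [Finset.sum_boole]
  have hfilter : (Finset.range M).filter (fun j : ℕ => (j : ℝ) + 1 ≤ p) = Finset.range ⌊p⌋₊ := by
    ext j
    simp only [Finset.mem_filter, Finset.mem_range]
    have hle : ⌊p⌋₊ < M + 1 := (Nat.floor_lt hp).mpr (by exact_mod_cast hpM)
    constructor
    · rintro ⟨-, hj⟩
      have : j + 1 ≤ ⌊p⌋₊ := Nat.le_floor (by exact_mod_cast hj)
      omega
    · intro hj
      refine ⟨by omega, ?_⟩
      have : ((j + 1 : ℕ) : ℝ) ≤ p := (Nat.le_floor_iff hp).mp (by omega)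
      exact_mod_cast this
  rw [hfilter, Finset.card_range, natCast_floor_eq_intCast_floor hp]

/-- **Layer cake**: for `0 ≤ p, q < M + 1`, `|⌊p⌋ − ⌊q⌋| ≤ Σ_{j<M} |𝟙[j + 1 ≤ p] − 𝟙[j + 1 ≤ q]|`. -/
theorem abs_floor_sub_floor_le_sum {p q : ℝ} (hp : 0 ≤ p) (hq : 0 ≤ q) {M : ℕ} (hpM : p < M + 1)
    (hqM : q < M + 1) :
    |(⌊p⌋ : ℝ) - ⌊q⌋| ≤ ∑ j ∈ Finset.range M,
      |(if (j : ℝ) + 1 ≤ p then (1 : ℝ) else 0) - (if (j : ℝ) + 1 ≤ q then (1 : ℝ) else 0)| := by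
  rw [floor_eq_sum_ite hp hpM, floor_eq_sum_ite hq hqM, ← Finset.sum_sub_distrib]
  exact Finset.abs_sum_le_sum_abs _ _

/-! ### One level of one form: the disagreement interval and its `u⁻²`-mass -/

/-- **Level `m` disagrees between `u·x` and `u·y` only on `[m/max(x,y), m/min(x,y)]`** (`x, y, m > 0`). -/
theorem abs_ite_sub_ite_le_indicator {x y m : ℝ} (hx : 0 < x) (hy : 0 < y) (hm : 0 < m) (u : ℝ) :
    |(if m ≤ u * y then (1 : ℝ) else 0) - (if m ≤ u * x then (1 : ℝ) else 0)|
      ≤ (Icc (m / max x y) (m / min x y)).indicator (fun _ => (1 : ℝ)) u := by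
  by_cases hu : u ∈ Icc (m / max x y) (m / min x y)
  · rw [Set.indicator_of_mem hu]
    split_ifs <;> simp
  · rw [Set.indicator_of_notMem hu]
    rw [Set.mem_Icc, not_and_or, not_le, not_le] at hu
    have hmax : 0 < max x y := lt_max_of_lt_left hx
    have hmin : 0 < min x y := lt_min hx hy
    rcases hu with h | h
    · -- below the interval: neither level is reached
      rw [lt_div_iff₀ hmax] at h
      have h1 : ¬ m ≤ u * y := by
        intro h'
        rcases le_or_gt 0 u with hu0 | hu0
        · have := mul_le_mul_of_nonneg_left (le_max_right x y) hu0; linarith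
        · have := mul_neg_of_neg_of_pos hu0 hy; linarith
      have h2 : ¬ m ≤ u * x := by
        intro h'
        rcases le_or_gt 0 u with hu0 | hu0
        · have := mul_le_mul_of_nonneg_left (le_max_left x y) hu0; linarith
        · have := mul_neg_of_neg_of_pos hu0 hx; linarith
      simp [h1, h2]
    · -- above the interval: both levels are reached
      rw [div_lt_iff₀ hmin] at h
      have hu0 : 0 < u := by
        by_contra hu0; push Not at hu0
        have := mul_nonpos_of_nonpos_of_nonneg hu0 hmin.le
        linarith
      have h1 : m ≤ u * y := by
        have := mul_le_mul_of_nonneg_left (min_le_right x y) hu0.le; linarith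
      have h2 : m ≤ u * x := by
        have := mul_le_mul_of_nonneg_left (min_le_left x y) hu0.le; linarith
      simp [h1, h2]

/-- `∫_α^β u⁻² du = α⁻¹ − β⁻¹` for `0 < α ≤ β`. -/
theorem integral_Icc_inv_sq {α β : ℝ} (hα : 0 < α) (hαβ : α ≤ β) :
    ∫ u in α..β, (u ^ 2)⁻¹ = α⁻¹ - β⁻¹ := by
  have hderiv : ∀ u ∈ uIcc α β, HasDerivAt (fun u : ℝ => -u⁻¹) ((u ^ 2)⁻¹) u := by
    intro u hu
    rw [uIcc_of_le hαβ] at hu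
    have hu0 : u ≠ 0 := by linarith [hu.1]
    have h := (hasDerivAt_inv hu0).fun_neg
    rw [neg_neg] at h
    exact h
  have hcont : ContinuousOn (fun u : ℝ => (u ^ 2)⁻¹) (uIcc α β) := by
    refine ContinuousOn.inv₀ (by fun_prop) fun u hu => ?_
    rw [uIcc_of_le hαβ] at hu
    have : 0 < u := by linarith [hu.1]
    positivity
  rw [intervalIntegral.integral_eq_sub_of_hasDerivAt hderiv (hcont.intervalIntegrable)]
  ring

/-- `u ↦ u⁻²` is integrable on `[α, β]`, `α > 0`. -/
theorem integrableOn_inv_sq_Icc {α : ℝ} (hα : 0 < α) (β : ℝ) :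
    IntegrableOn (fun u : ℝ => (u ^ 2)⁻¹) (Icc α β) := by
  refine ContinuousOn.integrableOn_compact isCompact_Icc (ContinuousOn.inv₀ (by fun_prop) fun u hu => ?_)
  have : 0 < u := by linarith [hu.1]
  positivity

/-- **The `u⁻²`-mass of the disagreement interval inside `(0, T]`**:
`∫_{(0,T]} 𝟙_{[α,β]}(u)·u⁻² du ≤ α⁻¹ − β⁻¹` (`0 < α ≤ β`). -/
theorem setIntegral_indicator_inv_sq_le {α β : ℝ} (hα : 0 < α) (hαβ : α ≤ β) (T : ℝ) :
    ∫ u in Ioc 0 T, (Icc α β).indicator (fun _ => (1 : ℝ)) u * (u ^ 2)⁻¹ ≤ α⁻¹ - β⁻¹ := by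
  have hpt : ∀ u : ℝ, (Icc α β).indicator (fun _ => (1 : ℝ)) u * (u ^ 2)⁻¹
      = (Icc α β).indicator (fun u => (u ^ 2)⁻¹) u := by
    intro u
    by_cases hu : u ∈ Icc α β
    · simp [Set.indicator_of_mem hu]
    · simp [Set.indicator_of_notMem hu]
  simp_rw [hpt]
  have hint : Integrable ((Icc α β).indicator fun u : ℝ => (u ^ 2)⁻¹) volume :=
    (integrable_indicator_iff measurableSet_Icc).mpr (integrableOn_inv_sq_Icc hα β)
  calc ∫ u in Ioc 0 T, (Icc α β).indicator (fun u => (u ^ 2)⁻¹) u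
      ≤ ∫ u, (Icc α β).indicator (fun u => (u ^ 2)⁻¹) u :=
        setIntegral_le_integral hint (Filter.Eventually.of_forall fun u =>
          Set.indicator_nonneg (fun v _ => by positivity) _)
    _ = ∫ u in Icc α β, (u ^ 2)⁻¹ := integral_indicator measurableSet_Icc
    _ = α⁻¹ - β⁻¹ := by
        rw [integral_Icc_eq_integral_Ioc, ← intervalIntegral.integral_of_le hαβ, integral_Icc_inv_sq hα hαβ]

/-- The mass `max(x,y)/m − min(x,y)/m = |y − x|/m`. -/
theorem inv_div_max_sub_inv_div_min (x y m : ℝ) :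
    (m / max x y)⁻¹ - (m / min x y)⁻¹ = |y - x| / m := by
  rw [inv_div, inv_div, ← sub_div]
  congr 1
  rcases le_total x y with h | h
  · rw [max_eq_right h, min_eq_left h, abs_of_nonneg (by linarith)]
  · rw [max_eq_left h, min_eq_right h, abs_of_nonpos (by linarith)]; ring

/-! ### One form: harmonic sum over the levels -/

/-- **One form.** For `0 < x`, `0 < y` with `T·x < M + 1`, `T·y < M + 1`:
`∫_{(0,T]} |⌊u·y⌋ − ⌊u·x⌋|·u⁻² du ≤ |y − x|·(1 + log M)` (for `M ≥ 1`). -/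
theorem setIntegral_abs_floor_sub_floor_inv_sq_le {x y T : ℝ} (hx : 0 < x) (hy : 0 < y) {M : ℕ}
    (hM : 1 ≤ M) (hxM : T * x < M + 1) (hyM : T * y < M + 1) :
    ∫ u in Ioc 0 T, |(⌊u * y⌋ : ℝ) - ⌊u * x⌋| * (u ^ 2)⁻¹ ≤ |y - x| * (1 + Real.log M) := by
  have hmax : 0 < max x y := lt_max_of_lt_left hx
  have hmin : 0 < min x y := lt_min hx hy
  -- the dominating function: sum over the levels of the disagreement indicators
  set G : ℝ → ℝ := fun u => ∑ j ∈ Finset.range M,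
    (Icc (((j : ℝ) + 1) / max x y) (((j : ℝ) + 1) / min x y)).indicator (fun _ => (1 : ℝ)) u * (u ^ 2)⁻¹
    with hG
  have hlev : ∀ j : ℕ, (0 : ℝ) < (j : ℝ) + 1 := fun j => Nat.cast_add_one_pos j
  have hαβ : ∀ j : ℕ, ((j : ℝ) + 1) / max x y ≤ ((j : ℝ) + 1) / min x y := fun j =>
    div_le_div_of_nonneg_left (hlev j).le hmin (min_le_max)
  have hGint : Integrable G (volume.restrict (Ioc 0 T)) := by
    refine integrable_finsetSum _ fun j _ => ?_
    have hpt : (fun u : ℝ => (Icc (((j : ℝ) + 1) / max x y) (((j : ℝ) + 1) / min x y)).indicator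
        (fun _ => (1 : ℝ)) u * (u ^ 2)⁻¹)
        = (Icc (((j : ℝ) + 1) / max x y) (((j : ℝ) + 1) / min x y)).indicator fun u => (u ^ 2)⁻¹ := by
      funext u
      by_cases hu : u ∈ Icc (((j : ℝ) + 1) / max x y) (((j : ℝ) + 1) / min x y)
      · simp [Set.indicator_of_mem hu]
      · simp [Set.indicator_of_notMem hu]
    rw [hpt]
    exact ((integrable_indicator_iff measurableSet_Icc).mpr
      (integrableOn_inv_sq_Icc (div_pos (hlev j) hmax) _)).mono_measure Measure.restrict_le_self
  -- pointwise domination on `(0, T]`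
  have hdom : ∀ u ∈ Ioc 0 T, |(⌊u * y⌋ : ℝ) - ⌊u * x⌋| * (u ^ 2)⁻¹ ≤ G u := by
    intro u hu
    have hu0 : 0 < u := hu.1
    have huy : 0 ≤ u * y := (mul_pos hu0 hy).le
    have hux : 0 ≤ u * x := (mul_pos hu0 hx).le
    have huyM : u * y < M + 1 := (mul_le_mul_of_nonneg_right hu.2 hy.le).trans_lt hyM
    have huxM : u * x < M + 1 := (mul_le_mul_of_nonneg_right hu.2 hx.le).trans_lt hxM
    simp only [hG]
    rw [← Finset.sum_mul]
    refine mul_le_mul_of_nonneg_right ?_ (by positivity)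
    refine (abs_floor_sub_floor_le_sum huy hux huyM huxM).trans (Finset.sum_le_sum fun j _ => ?_)
    exact abs_ite_sub_ite_le_indicator hx hy (hlev j) u
  -- integrate
  have hGval : ∫ u in Ioc 0 T, G u ≤ |y - x| * (1 + Real.log M) := by
    rw [hG, integral_finsetSum _ fun j _ => ?_]
    · calc ∑ j ∈ Finset.range M, ∫ u in Ioc 0 T,
            (Icc (((j : ℝ) + 1) / max x y) (((j : ℝ) + 1) / min x y)).indicator (fun _ => (1 : ℝ)) u * (u ^ 2)⁻¹
          ≤ ∑ j ∈ Finset.range M, |y - x| / ((j : ℝ) + 1) := by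
            refine Finset.sum_le_sum fun j _ => ?_
            refine (setIntegral_indicator_inv_sq_le (div_pos (hlev j) hmax) (hαβ j) T).trans (le_of_eq ?_)
            exact inv_div_max_sub_inv_div_min x y _
        _ = |y - x| * ((harmonic M : ℚ) : ℝ) := by
            rw [harmonic_cast_eq_sum, Finset.mul_sum]
            refine Finset.sum_congr rfl fun j _ => ?_
            rw [div_eq_mul_one_div]
        _ ≤ |y - x| * (1 + Real.log M) :=
            mul_le_mul_of_nonneg_left (harmonic_le_one_add_log M) (abs_nonneg _)
    · have hpt : (fun u : ℝ => (Icc (((j : ℝ) + 1) / max x y) (((j : ℝ) + 1) / min x y)).indicator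
          (fun _ => (1 : ℝ)) u * (u ^ 2)⁻¹)
          = (Icc (((j : ℝ) + 1) / max x y) (((j : ℝ) + 1) / min x y)).indicator fun u => (u ^ 2)⁻¹ := by
        funext u
        by_cases hu : u ∈ Icc (((j : ℝ) + 1) / max x y) (((j : ℝ) + 1) / min x y)
        · simp [Set.indicator_of_mem hu]
        · simp [Set.indicator_of_notMem hu]
      rw [hpt]
      exact ((integrable_indicator_iff measurableSet_Icc).mpr
        (integrableOn_inv_sq_Icc (div_pos (hlev j) hmax) _)).mono_measure Measure.restrict_le_self
  have _ := hM
  calc ∫ u in Ioc 0 T, |(⌊u * y⌋ : ℝ) - ⌊u * x⌋| * (u ^ 2)⁻¹ ≤ ∫ u in Ioc 0 T, G u := by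
        refine integral_mono_of_nonneg (Filter.Eventually.of_forall fun u => by positivity) hGint ?_
        exact (ae_restrict_iff' measurableSet_Ioc).mpr (Filter.Eventually.of_forall hdom)
    _ ≤ |y - x| * (1 + Real.log M) := hGval

/-! ### The head period -/

/-- **The head period at harmonic scale** (desk-note §2, «Head»). For a direction with all forms positive, a
displacement `δ` and `0 ≤ ε` with `εT·Y ≤ 1`, `ε·Y ≤ x_min/2` (`Y = shiftSize δ`):
`|∫₀ᵀ Δ_ε(u) u⁻² du| ≤ ε·(Σ_k |φ_k(δ)|)·(1 + log(T·x_max + 1))`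
— form by form (fact (a)), level by level (`m ≤ T·x_k + 1`), the `u⁻²`-mass of the set where level `m` of form
`k` has been crossed by `u·(x_k + εφ_k)` but not by `u·x_k` (or conversely) is `≤ ε|φ_k|/m`. -/
theorem abs_head_integral_le_harmonic {a : Dir} (hpos : ∀ k, 0 < h28 a k) {T : ℝ} (hT : 0 < T) (δ : Fin 8 → ℝ)
    {ε : ℝ} (hε : 0 ≤ ε) (hεY : ε * T * shiftSize δ ≤ 1) (hεY2 : ε * shiftSize δ ≤ xMin a / 2) :
    |∫ u in (0 : ℝ)..T, ((torusN (u • sParam a + (u * ε) • δ) : ℝ) - torusN (u • sParam a)) / u ^ 2|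
      ≤ ε * (∑ k, |phiForm δ k|) * (1 + Real.log (T * xMax a + 1)) := by
  have hxM := xMax_pos hpos
  have hY := shiftSize_nonneg δ
  -- per-form data: `x_k`, `y_k = x_k + ε φ_k ≥ x_k / 2 > 0`, levels `M_k = ⌊T x_k⌋₊ + 1`
  have hyk : ∀ k, 0 < h28 a k + ε * phiForm δ k := by
    intro k
    have h1 : ε * |phiForm δ k| ≤ h28 a k / 2 :=
      (mul_le_mul_of_nonneg_left (abs_phiForm_le_shiftSize δ k) hε).trans
        (hεY2.trans (by linarith [xMin_le a k]))
    have h2 : -(ε * |phiForm δ k|) ≤ ε * phiForm δ k := by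
      rw [← mul_neg]; exact mul_le_mul_of_nonneg_left (neg_abs_le _) hε
    linarith [hpos k]
  set M : Fin 28 → ℕ := fun k => ⌊T * h28 a k⌋₊ + 1 with hM
  have hM1 : ∀ k, 1 ≤ M k := fun k => by simp [hM]
  have hMx : ∀ k, T * h28 a k < (M k : ℝ) + 1 := by
    intro k
    have := Nat.lt_floor_add_one (T * h28 a k)
    simp only [hM]; push_cast; linarith
  have hMy : ∀ k, T * (h28 a k + ε * phiForm δ k) < (M k : ℝ) + 1 := by
    intro k
    have h1 : T * (ε * phiForm δ k) ≤ 1 := by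
      have := mul_le_mul_of_nonneg_left ((le_abs_self _).trans (abs_phiForm_le_shiftSize δ k))
        (mul_nonneg hT.le hε)
      nlinarith
    have := Nat.lt_floor_add_one (T * h28 a k)
    simp only [hM]; push_cast; nlinarith
  have hMle : ∀ k, (M k : ℝ) ≤ T * xMax a + 1 := by
    intro k
    simp only [hM]; push_cast
    have h1 : (⌊T * h28 a k⌋₊ : ℝ) ≤ T * h28 a k := Nat.floor_le (mul_nonneg hT.le (hpos k).le)
    have h2 : T * h28 a k ≤ T * xMax a := mul_le_mul_of_nonneg_left (le_xMax a k) hT.le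
    linarith
  have hlogM : ∀ k, Real.log (M k) ≤ Real.log (T * xMax a + 1) := fun k =>
    Real.log_le_log (by have := hM1 k; positivity) (hMle k)
  -- the dominating function
  set Δ : ℝ → ℝ := fun u => (torusN (u • sParam a + (u * ε) • δ) : ℝ) - torusN (u • sParam a) with hΔ
  set G : ℝ → ℝ := fun u => ∑ k : Fin 28,
    |(⌊u * (h28 a k + ε * phiForm δ k)⌋ : ℝ) - ⌊u * h28 a k⌋| * (u ^ 2)⁻¹ with hG
  have hdom : ∀ u ∈ Ioc 0 T, ‖Δ u / u ^ 2‖ ≤ G u := by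
    intro u hu
    rw [Real.norm_eq_abs, abs_div, abs_of_pos (pow_pos hu.1 2), div_eq_mul_inv]
    simp only [hG]
    rw [← Finset.sum_mul]
    refine mul_le_mul_of_nonneg_right ?_ (by positivity)
    have h := abs_torusN_sub_le_sum_abs_floor_sub (u • sParam a) (u • sParam a + (u * ε) • δ)
    refine h.trans (le_of_eq (Finset.sum_congr rfl fun k _ => ?_))
    rw [phiForm_add, phiForm_smul_sParam, phiForm_smul,
      show u * h28 a k + u * ε * phiForm δ k = u * (h28 a k + ε * phiForm δ k) by ring]
  -- integrability of the dominating function, form by form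
  have hGk : ∀ k : Fin 28, IntegrableOn
      (fun u : ℝ => |(⌊u * (h28 a k + ε * phiForm δ k)⌋ : ℝ) - ⌊u * h28 a k⌋| * (u ^ 2)⁻¹) (Ioc 0 T) := by
    intro k
    -- bounded by the integrable level sum? simpler: `|⌊uy⌋ − ⌊ux⌋|` is a difference of monotone functions and
    -- vanishes for `u < 1/(2 max)`; we dominate by the constant `(M k + 1)·(2·max)²` on `(0,T]` instead.
    have hx := hpos k
    have hy := hyk k
    set c : ℝ := 1 / (h28 a k + (h28 a k + ε * phiForm δ k)) with hc
    have hc0 : 0 < c := by rw [hc]; positivity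
    have hmeas : AEStronglyMeasurable
        (fun u : ℝ => |(⌊u * (h28 a k + ε * phiForm δ k)⌋ : ℝ) - ⌊u * h28 a k⌋| * (u ^ 2)⁻¹)
        (volume.restrict (Ioc 0 T)) := by
      refine AEStronglyMeasurable.mul ?_ ?_
      · have h1 : Measurable fun u : ℝ => (⌊u * (h28 a k + ε * phiForm δ k)⌋ : ℝ) :=
          (measurable_of_countable _).comp (measurable_id.mul_const _).floor
        have h2 : Measurable fun u : ℝ => (⌊u * h28 a k⌋ : ℝ) :=
          (measurable_of_countable _).comp (measurable_id.mul_const _).floor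
        exact ((h1.sub h2).abs).aestronglyMeasurable
      · exact (measurable_id.pow_const 2).inv.aestronglyMeasurable
    refine ⟨hmeas, ?_⟩
    refine HasFiniteIntegral.of_bounded (C := ((M k : ℝ) + 1 + ((M k : ℝ) + 1)) * (c ^ 2)⁻¹) ?_
    refine (ae_restrict_iff' measurableSet_Ioc).mpr (Filter.Eventually.of_forall fun u hu => ?_)
    rw [Real.norm_eq_abs, abs_mul, abs_abs,
      abs_of_pos (show (0 : ℝ) < (u ^ 2)⁻¹ by have := hu.1; positivity)]
    rcases lt_or_ge u c with huc | huc
    · -- below `c` both floors vanish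
      have hu0 : 0 < u := hu.1
      have e1 : ⌊u * (h28 a k + ε * phiForm δ k)⌋ = 0 := by
        rw [Int.floor_eq_zero_iff]
        refine ⟨(mul_pos hu0 hy).le, ?_⟩
        calc u * (h28 a k + ε * phiForm δ k) < c * (h28 a k + ε * phiForm δ k) :=
              mul_lt_mul_of_pos_right huc hy
          _ ≤ 1 := by rw [hc, div_mul_eq_mul_div, one_mul, div_le_one (by positivity)]; linarith
      have e2 : ⌊u * h28 a k⌋ = 0 := by
        rw [Int.floor_eq_zero_iff]
        refine ⟨(mul_pos hu0 hx).le, ?_⟩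
        calc u * h28 a k < c * h28 a k := mul_lt_mul_of_pos_right huc hx
          _ ≤ 1 := by rw [hc, div_mul_eq_mul_div, one_mul, div_le_one (by positivity)]; linarith
      rw [e1, e2]; simp only [Int.cast_zero, sub_self, abs_zero, zero_mul]
      positivity
    · -- above `c` the weight is at most `c⁻²` and the floors are at most `M k + 1`
      have hu0 : 0 < u := hu.1
      have hw : (u ^ 2)⁻¹ ≤ (c ^ 2)⁻¹ := by
        rw [inv_le_inv₀ (by positivity) (by positivity)]
        exact pow_le_pow_left₀ hc0.le huc 2
      have hf1 : |(⌊u * (h28 a k + ε * phiForm δ k)⌋ : ℝ)| ≤ (M k : ℝ) + 1 := by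
        rw [abs_of_nonneg (by exact_mod_cast Int.floor_nonneg.mpr (mul_pos hu0 hy).le)]
        have h1 : (⌊u * (h28 a k + ε * phiForm δ k)⌋ : ℝ) ≤ u * (h28 a k + ε * phiForm δ k) := Int.floor_le _
        have h2 : u * (h28 a k + ε * phiForm δ k) ≤ T * (h28 a k + ε * phiForm δ k) :=
          mul_le_mul_of_nonneg_right hu.2 hy.le
        linarith [hMy k]
      have hf2 : |(⌊u * h28 a k⌋ : ℝ)| ≤ (M k : ℝ) + 1 := by
        rw [abs_of_nonneg (by exact_mod_cast Int.floor_nonneg.mpr (mul_pos hu0 hx).le)]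
        have h1 : (⌊u * h28 a k⌋ : ℝ) ≤ u * h28 a k := Int.floor_le _
        have h2 : u * h28 a k ≤ T * h28 a k := mul_le_mul_of_nonneg_right hu.2 hx.le
        linarith [hMx k]
      have hf : |(⌊u * (h28 a k + ε * phiForm δ k)⌋ : ℝ) - ⌊u * h28 a k⌋| ≤ (M k : ℝ) + 1 + ((M k : ℝ) + 1) :=
        (abs_sub _ _).trans (add_le_add hf1 hf2)
      exact mul_le_mul hf hw (by positivity) (by positivity)
  have hGint : IntervalIntegrable G volume 0 T := by
    rw [intervalIntegrable_iff_integrableOn_Ioc_of_le hT.le]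
    exact integrable_finsetSum _ fun k _ => hGk k
  -- assemble
  have h := intervalIntegral.norm_integral_le_of_norm_le (f := fun u => Δ u / u ^ 2) hT.le
    (Filter.Eventually.of_forall hdom) hGint
  rw [Real.norm_eq_abs] at h
  refine h.trans ?_
  rw [intervalIntegral.integral_of_le hT.le, hG, integral_finsetSum _ fun k _ => hGk k]
  calc ∑ k : Fin 28, ∫ u in Ioc 0 T, |(⌊u * (h28 a k + ε * phiForm δ k)⌋ : ℝ) - ⌊u * h28 a k⌋| * (u ^ 2)⁻¹
      ≤ ∑ k : Fin 28, |h28 a k + ε * phiForm δ k - h28 a k| * (1 + Real.log (M k)) :=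
        Finset.sum_le_sum fun k _ =>
          setIntegral_abs_floor_sub_floor_inv_sq_le (hpos k) (hyk k) (hM1 k) (hMx k) (hMy k)
    _ ≤ ∑ k : Fin 28, (ε * |phiForm δ k|) * (1 + Real.log (T * xMax a + 1)) := by
        refine Finset.sum_le_sum fun k _ => ?_
        rw [show h28 a k + ε * phiForm δ k - h28 a k = ε * phiForm δ k by ring, abs_mul, abs_of_nonneg hε]
        refine mul_le_mul_of_nonneg_left (by linarith [hlogM k]) (by positivity)
    _ = ε * (∑ k, |phiForm δ k|) * (1 + Real.log (T * xMax a + 1)) := by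
        rw [Finset.mul_sum, Finset.sum_mul]

end Summit.KontsevichZagierPeriods.Zeta5Search.Barrier.ConeGamma

end
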